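import Mathlib
import Summits.ValiantsHypothesis.ValiantsHypothesis.Theorems.PermanentalConesPermanentalHyperbolic
import Summits.ValiantsHypothesis.ValiantsHypothesis.Theorems.PermanentalConesPermanentalConeHardSlackAsPermanent
import Summits.ValiantsHypothesis.ValiantsHypothesis.Theorems.PermanentalConesPermanentalConeHardAllOnesNotWitness
import Summits.ValiantsHypothesis.ValiantsHypothesis.Theorems.PermanentalConesPermanentalConeHardTwoRowsColScale
import Summits.ValiantsHypothesis.ValiantsHypothesis.Theorems.PermanentalConesPermanentalConeHardTwoRowsLineProd
import Summits.ValiantsHypothesis.ValiantsHypothesis.Theorems.PermanentalConesPermanentalConeHardTwoRowsCongruence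
import Summits.ValiantsHypothesis.ValiantsHypothesis.Theorems.PermanentalConesPermanentalConeHardTwoRowsEval
import Literature.AlgebraicGeometry.HyperbolicPolynomials.HyperbolicityCone
import Literature.AlgebraicGeometry.HyperbolicPolynomials.Garding
import Literature.AlgebraicGeometry.HyperbolicPolynomials.SmoothBoundary
import Literature.AlgebraicGeometry.HyperbolicPolynomials.CompressionDeterminant
import Literature.AlgebraicGeometry.HyperbolicPolynomials.SpectrahedralShadow
import Literature.AlgebraicGeometry.HyperbolicPolynomials.SpectrahedralShadowProofs
import Literature.Analysis.Convex.SpectralConeLift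
import Literature.Analysis.Convex.ConeLift

import Summits.ValiantsHypothesis.ValiantsHypothesis.Theorems.PermanentalConesPermanentalConeHardOneRowNotWitness
import Summits.ValiantsHypothesis.ValiantsHypothesis.Theorems.PermanentalConesPermanentalConeHardOrthantNotWitness
/-!
# `PermanentalConeHard` (stmt-ValiantsHypothesis-8654), line `birth` — two positive rows are never a witness

Route `PermanentalCones` of `ValiantsHypothesis`, crux `PermanentalConeHard` (H+).  A level-`c`
witness of H+ is a permanental polynomial `Q = per[(Y)_{rows<r}; x^{(N-r)}]` whose closed
hyperbolicity cone `Λ₊(Q, 𝟙)` has NO lifted-LMI description of size `≤ 2^((log₂ N + c)^c)`.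
This file removes the first genuinely MIXED members from the witness pool: two constant rows
`b = Y₀ > 0`, `a = Y₁ > 0` (`r = 2`).  Then `Q = (N-2)!·D_a D_b e_N` and

  `Λ₊(Q, 𝟙) = Diag(b) · L⁻¹(spec Λ₊(e_{n-1}^{(n)}, 𝟙))`,  `n = N - 1`,
  `L(y) = Tᵀ (Vᵀ diag(y) V) T`,  `Tᵀ (Vᵀ diag(a/b) V) T = I`,

i.e. the cone is a diagonal image of a linear preimage of the SPECTRAL first derivative
relaxation of `S^n_+` (Sanyal's `e_{N-1}(y) = N det(Vᵀdiag(y)V)`, Saunderson–Parrilo Prop. 4 in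
the direction `a/b`, Gårding's direction change `b⁻¹ ↝ 𝟙 ↝ a/b`), hence has a lifted LMI of size
`≤ 2^((log₂ N + 4)^4)` by Saunderson–Parrilo Prop. 1 (spectral sets, tree:
`hasExpPsdLift_spectralSet`) and Thm. 1 (tree: `hasExpPsdLift_cone_deriv`).  So members with
`r n = 2` positive rows fail the size clause at level `c = 4` for every `N` — the `TwoDirections`
statement foreseen under the Easy crux 8652, in no-go form.

Infrastructure stubs (wave 1 of lead c3): `stub_rowPermanent_colScale` (column scaling),
`stub_rowPermanent_two_eval` (`per[𝟙; a; z^{(N-2)}] = (N-2)!·⟨∇e_{N-1}(z), a⟩`),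
`stub_compressionCongruence` (`e_n(y + u a) = c ∏ (u + d_j)` for `Tᵀ(Vᵀdiag(y)V)T = U diag(d) Uᵀ`),
`stub_gradForm_of_line_prod` (`⟨∇f(y + τv), v⟩ = c·e_{n-1}(d + τ𝟙)`).

References: Saunderson–Parrilo, Math. Program. 153 (2015) (arXiv:1208.1443) Props. 1, 2, 4,
Thm. 1; R. Sanyal, *On the derivative cones of polyhedral cones*, Adv. Geom. 13 (2013)
(`e_{n-1} = n det(Vᵀ diag V)`); Gårding 1959 (direction independence).
-/

set_option linter.dupNamespace false

noncomputable section

namespace Summit.ValiantsHypothesis.ValiantsHypothesis.Theorems.PermanentalConesPermanentalConeHard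

open MvPolynomial Finset Matrix
open scoped BigOperators Polynomial Matrix
open Literature.AlgebraicGeometry.HyperbolicPolynomials Literature.Analysis.Convex


/-! ## Two positive rows -/

section TwoRows

/-- `Tᵀ (Vᵀ diag(y) V) T` is symmetric. [folklore] -/
theorem isHermitian_conj_compression {p q : ℕ} (V : Matrix (Fin p) (Fin q) ℝ)
    (T : Matrix (Fin q) (Fin q) ℝ) (y : Fin p → ℝ) :
    (Tᵀ * (Vᵀ * diagonal y * V) * T).IsHermitian := by
  rw [Matrix.IsHermitian, conjTranspose_eq_transpose_of_trivial, transpose_mul, transpose_mul,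
    transpose_transpose, transpose_mul, transpose_mul, transpose_transpose, diagonal_transpose]
  simp only [Matrix.mul_assoc]

/-- The size of the lift is within the level-`4` budget (via `AllOnes.size_le`). [folklore] -/
theorem twoRows_size_le (k : ℕ) :
    k + 1 * (2 + (k + 1) * (2 * (k + 1) + 1)) + 2 + (k + 1) * (2 * (k + 1) + 1) ≤
      2 ^ ((Nat.log 2 (k + 1 + 1) + 4) ^ 4) := by
  refine le_trans ?_ (AllOnes.size_le (k + 1 + 1) 2)
  have h1 : (k + 1) * (2 * (k + 1) + 1) ≤ (k + 1 + 1) * (2 * (k + 1 + 1) + 1) :=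
    Nat.mul_le_mul (by omega) (by omega)
  have h2 : min 2 (k + 1 + 1) = 2 := min_eq_left (by omega)
  rw [h2]
  omega

/-- **Registered form (`stub_twoRowsNotWitness`, no-go infrastructure of the core
`stub_permanentalGradientPsdRank`).**  A permanental polynomial with TWO entrywise-positive
constant rows has a closed hyperbolicity cone (w.r.t. `𝟙`) with a lifted-LMI description of size
`≤ 2^((log₂ N + 4)^4)` — so it meets the size clause of H+ at level `c = 4` for every `N` and is
never a witness.  The cone is `Diag(b)·L⁻¹(spec Λ₊(e_{n-1}^{(n)}))` (module doc).
[cite: SaundersonParrilo2014, Proposition 4] -/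
theorem stub_twoRowsNotWitness : ∀ (N : ℕ) (Y : Matrix (Fin N) (Fin N) ℝ), (∀ i j, 0 < Y i j) → ∀ P : MvPolynomial (Fin N) ℝ, P = (Matrix.of fun i j : Fin N => if (i : ℕ) < 2 then MvPolynomial.C (Y i j) else MvPolynomial.X j).permanent → ∃ m ≤ 2 ^ ((Nat.log 2 N + 4) ^ 4), ∃ (p : ℕ) (A : (Fin N → ℝ) × (Fin p → ℝ) →ₗ[ℝ] Matrix (Fin m) (Fin m) ℝ) (B : Matrix (Fin m) (Fin m) ℝ), ∀ x : Fin N → ℝ, (∀ τ : ℝ, 0 < τ → MvPolynomial.eval (fun j => x j + τ) P ≠ 0) ↔ ∃ y : Fin p → ℝ, (A (x, y) + B).PosSemidef := by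
  classical
  intro N Y hY P hP
  rcases Nat.lt_or_ge N 3 with hN | hN
  · /- `N ≤ 2`: every row is constant, `P = C (per Y) > 0`, the cone is everything (size `0`). -/
    have hmat : (Matrix.of fun i j : Fin N =>
        if (i : ℕ) < 2 then C (Y i j) else (X j : MvPolynomial (Fin N) ℝ)) =
        (Matrix.of fun i j : Fin N => Y i j).map C := by
      ext i j
      have hi : (i : ℕ) < 2 := by omega
      simp only [Matrix.of_apply, Matrix.map_apply, if_pos hi]
    have hconst : P = C ((Matrix.of fun i j : Fin N => Y i j).permanent) := by
      rw [hP, hmat, ← Theorems.ringHom_map_permanent]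
    refine ⟨0, Nat.zero_le _, ?_⟩
    obtain ⟨p, A, B, h⟩ :=
      (isSpectrahedralShadowOfSize_univ_zero : IsSpectrahedralShadowOfSize (Set.univ : Set (Fin N → ℝ)) 0)
    refine ⟨p, A, B, fun x => ?_⟩
    rw [← h x]
    simp only [Set.mem_univ, iff_true]
    intro τ _
    rw [hconst, MvPolynomial.eval_C]
    exact (permanent_pos fun a b => by simpa using hY a b).ne'
  · /- `N = k + 2 ≥ 3`. -/
    obtain ⟨k, rfl⟩ : ∃ k, N = k + 1 + 1 := ⟨N - 2, by omega⟩
    -- the two rows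
    set i0 : Fin (k + 1 + 1) := ⟨0, by omega⟩ with hi0
    set i1 : Fin (k + 1 + 1) := ⟨1, by omega⟩ with hi1
    set b : Fin (k + 1 + 1) → ℝ := fun j => Y i0 j with hb
    set a' : Fin (k + 1 + 1) → ℝ := fun j => Y i1 j * (Y i0 j)⁻¹ with ha'
    have hbpos : ∀ j, 0 < b j := fun j => hY i0 j
    have hbne : ∀ j, b j ≠ 0 := fun j => (hbpos j).ne'
    have ha'pos : ∀ j, 0 < a' j := fun j => mul_pos (hY i1 j) (inv_pos.2 (hY i0 j))
    set binv : Fin (k + 1 + 1) → ℝ := fun j => (b j)⁻¹ with hbinv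
    have hbinvpos : ∀ j, 0 < binv j := fun j => inv_pos.2 (hbpos j)
    -- the rescaled member `P' = per[𝟙; a'; x^{(N-2)}]`
    set Y' : Fin (k + 1 + 1) → Fin (k + 1 + 1) → ℝ := fun i j => if (i : ℕ) = 0 then 1 else a' j
      with hY'
    have hY'pos : ∀ i j, 0 < Y' i j := by
      intro i j
      simp only [hY']
      split_ifs
      · exact one_pos
      · exact ha'pos j
    set P' : MvPolynomial (Fin (k + 1 + 1)) ℝ := (Matrix.of fun i j : Fin (k + 1 + 1) =>
      if (i : ℕ) < 2 then MvPolynomial.C (if (i : ℕ) = 0 then (1 : ℝ) else a' j)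
      else MvPolynomial.X j).permanent with hP'
    have hP'Y : P' = (Matrix.of fun i j : Fin (k + 1 + 1) =>
        if (i : ℕ) < 2 then C (Y' i j) else (X j : MvPolynomial (Fin (k + 1 + 1)) ℝ)).permanent := rfl
    -- Step A: column scaling `x = b ∘ y`
    have hscaled : (Matrix.of fun i j : Fin (k + 1 + 1) =>
        if (i : ℕ) < 2 then MvPolynomial.C (Y i j * (b j)⁻¹) else MvPolynomial.X j).permanent = P' := by
      rw [hP']
      congr 1
      refine Matrix.ext fun i j => ?_
      simp only [Matrix.of_apply]
      split_ifs with h2 h0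
      · have hi : i = i0 := Fin.ext h0
        have h1 : Y i0 j * (Y i0 j)⁻¹ = 1 := mul_inv_cancel₀ (hbne j)
        rw [hi, h1]
      · have hi : i = i1 := Fin.ext (by simp only [hi1]; omega)
        rw [hi]
      · rfl
    have hA : ∀ x : Fin (k + 1 + 1) → ℝ,
        (∀ τ : ℝ, 0 < τ → MvPolynomial.eval (fun j => x j + τ) P ≠ 0) ↔
          (fun j => (b j)⁻¹ * x j) ∈ hyperbolicityCone P' binv := by
      intro x
      rw [mem_hyperbolicityCone_iff]
      refine forall_congr' fun τ => forall_congr' fun _ => ?_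
      have hxτ : (fun j => x j + τ) = fun j => b j * ((b j)⁻¹ * x j + τ * (b j)⁻¹) := by
        funext j
        rw [mul_add, mul_inv_cancel_left₀ (hbne j), mul_comm τ, mul_inv_cancel_left₀ (hbne j)]
      have hpt : ((fun j => (b j)⁻¹ * x j) + τ • binv) = fun j => (b j)⁻¹ * x j + τ * (b j)⁻¹ := by
        funext j
        simp [hbinv]
      rw [hP, hxτ, stub_rowPermanent_colScale (k + 1 + 1) 2 Y b _ hbne, hscaled, hpt]
      have hprod : (∏ j, b j) ≠ 0 := Finset.prod_ne_zero_iff.2 fun j _ => hbne j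
      exact ⟨fun h h0 => h (by rw [h0, mul_zero]), fun h h0 => h ((mul_eq_zero.1 h0).resolve_left hprod)⟩
    -- Step B: direction changes `b⁻¹ ↝ 𝟙 ↝ a'`
    have hhom' := isHomogeneous_rowPermanent Y' 2
    rw [← hP'Y] at hhom'
    have h1' : MvPolynomial.eval (fun _ => (1 : ℝ)) P' ≠ 0 := by
      have h := mem_openHyperbolicityCone_rowPermanent_of_pos Y' 2 hY'pos (v := fun _ => (1 : ℝ))
        (fun _ => one_pos) 0 le_rfl
      rw [← hP'Y] at h
      simpa using h
    have hIs' : IsHyperbolic P' (fun _ => (1 : ℝ)) := by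
      refine ⟨h1', fun x z hz => ?_⟩
      refine Summit.ValiantsHypothesis.ValiantsHypothesis.Theorems.permanentalHyperbolic_proof
        (k + 1 + 1) 2 (Matrix.of fun i j => Y' i j) (fun i j => (hY'pos i j).le) P' ?_ h1' x z ?_
      · rw [hP'Y]; rfl
      · simpa using hz
    have hbinv_mem : binv ∈ openHyperbolicityCone P' (fun _ => (1 : ℝ)) := by
      rw [hP'Y]; exact mem_openHyperbolicityCone_rowPermanent_of_pos Y' 2 hY'pos hbinvpos
    have ha'_mem : a' ∈ openHyperbolicityCone P' (fun _ => (1 : ℝ)) := by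
      rw [hP'Y]; exact mem_openHyperbolicityCone_rowPermanent_of_pos Y' 2 hY'pos ha'pos
    have hB : hyperbolicityCone P' binv = hyperbolicityCone P' a' := by
      rw [hyperbolicityCone_eq_of_mem hhom' hIs' hbinv_mem, hyperbolicityCone_eq_of_mem hhom' hIs' ha'_mem]
    -- Step C/D: the matrix model in direction `a'`
    obtain ⟨V, hV1, -, hV3⟩ := exists_compressionMatrix (k + 1)
    obtain ⟨T, c, hc, -, -, hprod⟩ := stub_compressionCongruence (k + 1) V hV1 hV3 a' ha'pos
    have hkey : ∀ (y : Fin (k + 1 + 1) → ℝ) (U : Matrix (Fin (k + 1)) (Fin (k + 1)) ℝ)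
        (d : Fin (k + 1) → ℝ), U * Uᵀ = 1 → Tᵀ * (Vᵀ * diagonal y * V) * T = U * diagonal d * Uᵀ →
        (y ∈ hyperbolicityCone P' a' ↔
          d ∈ hyperbolicityCone (MvPolynomial.esymm (Fin (k + 1)) ℝ k) (fun _ => (1 : ℝ))) := by
      intro y U d hU hM
      have hline : ∀ u : ℝ, MvPolynomial.eval (y + u • a') (MvPolynomial.esymm (Fin (k + 1 + 1)) ℝ (k + 1)) =
          c * ∏ j, (u + d j) := fun u => hprod y u U d hU hM
      have hgrad := stub_gradForm_of_line_prod (k + 1 + 1) (k + 1)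
        (MvPolynomial.esymm (Fin (k + 1 + 1)) ℝ (k + 1)) y a' c d (by omega) hline
      rw [mem_hyperbolicityCone_iff, mem_hyperbolicityCone_iff]
      refine forall_congr' fun τ => forall_congr' fun _ => ?_
      rw [stub_rowPermanent_two_eval (k + 1 + 1) (by omega) a' (y + τ • a')]
      have hsub : k + 1 + 1 - 1 = k + 1 := rfl
      have hsub' : k + 1 - 1 = k := rfl
      rw [hsub] ; rw [hgrad τ, hsub']
      have hfac : (((k + 1 + 1 - 2).factorial : ℕ) : ℝ) ≠ 0 := by exact_mod_cast (Nat.factorial_pos _).ne'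
      have hpt : (d + τ • fun _ : Fin (k + 1) => (1 : ℝ)) = fun j => d j + τ := by
        funext j; simp
      rw [hpt]
      constructor
      · intro h h0
        exact h (by rw [h0, mul_zero, mul_zero])
      · intro h h0
        rcases mul_eq_zero.1 h0 with h0 | h0
        · exact hfac h0
        · rcases mul_eq_zero.1 h0 with h0 | h0
          · exact hc.ne' h0
          · exact h h0
    -- the spectral set and the linear map
    set S : Set (Matrix (Fin (k + 1)) (Fin (k + 1)) ℝ) :=
      {M | ∃ U : Matrix (Fin (k + 1)) (Fin (k + 1)) ℝ, U * Uᵀ = 1 ∧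
        ∃ z ∈ hyperbolicityCone (MvPolynomial.esymm (Fin (k + 1)) ℝ k) (fun _ => (1 : ℝ)),
          M = U * diagonal z * Uᵀ} with hS
    have hmemS : ∀ y : Fin (k + 1 + 1) → ℝ,
        y ∈ hyperbolicityCone P' a' ↔ Tᵀ * (Vᵀ * diagonal y * V) * T ∈ S := by
      intro y
      constructor
      · intro hy
        obtain ⟨U, hU, hM⟩ := exists_orthogonal_conj_diagonal (isHermitian_conj_compression V T y)
        exact ⟨U, hU, _, (hkey y U _ hU hM).1 hy, hM⟩
      · rintro ⟨U, hU, z, hz, hM⟩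
        exact (hkey y U z hU hM).2 hz
    let L : (Fin (k + 1 + 1) → ℝ) →ₗ[ℝ] Matrix (Fin (k + 1)) (Fin (k + 1)) ℝ :=
      { toFun := fun x => Tᵀ * (Vᵀ * diagonal (fun j => (b j)⁻¹ * x j) * V) * T
        map_add' := fun x x' => by
          have : (fun j => (b j)⁻¹ * (x + x') j) =
              fun j => (b j)⁻¹ * x j + (b j)⁻¹ * x' j := by
            funext j; simp [mul_add]
          rw [this, ← diagonal_add, Matrix.mul_add, Matrix.add_mul, Matrix.mul_add, Matrix.add_mul]
        map_smul' := fun r x => by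
          have : (fun j => (b j)⁻¹ * (r • x) j) = r • fun j => (b j)⁻¹ * x j := by
            funext j; simp; ring
          rw [this, RingHom.id_apply, diagonal_smul, Matrix.mul_smul, Matrix.smul_mul,
            Matrix.mul_smul, Matrix.smul_mul] }
    have hL : ∀ x, L x = Tᵀ * (Vᵀ * diagonal (fun j => (b j)⁻¹ * x j) * V) * T := fun x => rfl
    have hKset : L ⁻¹' S =
        {x : Fin (k + 1 + 1) → ℝ | ∀ τ : ℝ, 0 < τ → MvPolynomial.eval (fun j => x j + τ) P ≠ 0} := by
      ext x
      show L x ∈ S ↔ ∀ τ : ℝ, 0 < τ → MvPolynomial.eval (fun j => x j + τ) P ≠ 0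
      rw [hA x, hB, hmemS, hL]
    -- Step E: the lift
    have hperm := comp_perm_mem_cone (N := k + 1) (d := k)
    have hcone : HasExpPsdLift
        (hyperbolicityCone (MvPolynomial.esymm (Fin (k + 1)) ℝ k) (fun _ => (1 : ℝ))) 0
          (k + 1 * (2 + (k + 1) * (2 * (k + 1) + 1))) := hasExpPsdLift_cone_deriv k 1
    have hSpec := hasExpPsdLift_spectralSet hcone hperm
    have hlift : HasExpPsdLift
        {x : Fin (k + 1 + 1) → ℝ | ∀ τ : ℝ, 0 < τ → MvPolynomial.eval (fun j => x j + τ) P ≠ 0} 0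
          (k + 1 * (2 + (k + 1) * (2 * (k + 1) + 1)) + 2 + (k + 1) * (2 * (k + 1) + 1)) := by
      rw [← hKset]
      exact hSpec.comap_linearMap L
    obtain ⟨p, A, B, hrep⟩ := isSpectrahedralShadowOfSize_of_hasExpPsdLift hlift
    exact ⟨_, twoRows_size_le k, p, A, B, fun x => hrep x⟩

/-! ## Families with at most two positive constant rows are never H+ witnesses -/

/-- **Easy-side conclusion for families with `r n ≤ 2` positive rows**: every member has a
lifted-LMI description of size `≤ 2^((log₂ n + 4)^4)` (`r n = 0`: the orthant,
`stub_orthantNotWitness`; `r n = 1`: `stub_oneRowNotWitness`; `r n = 2`: `stub_twoRowsNotWitness`).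
[cite: SaundersonParrilo2014, Theorem 1] -/
theorem permanental_atMostTwoRows_lift (r : ℕ → ℕ) (Y : ∀ n : ℕ, Matrix (Fin n) (Fin n) ℝ)
    (hY : ∀ n i j, 0 < Y n i j) (hr : ∀ n, r n ≤ 2) (P : ∀ n : ℕ, MvPolynomial (Fin n) ℝ)
    (hP : ∀ n, P n = (Matrix.of fun i j : Fin n =>
      if (i : ℕ) < r n then MvPolynomial.C (Y n i j) else MvPolynomial.X j).permanent) (n : ℕ) :
    ∃ m ≤ 2 ^ ((Nat.log 2 n + 4) ^ 4), ∃ (p : ℕ)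
      (A : (Fin n → ℝ) × (Fin p → ℝ) →ₗ[ℝ] Matrix (Fin m) (Fin m) ℝ) (B : Matrix (Fin m) (Fin m) ℝ),
      ∀ x : Fin n → ℝ, (∀ τ : ℝ, 0 < τ → MvPolynomial.eval (fun j => x j + τ) (P n) ≠ 0) ↔
        ∃ y : Fin p → ℝ, (A (x, y) + B).PosSemidef := by
  have hPn := hP n
  rcases Nat.lt_or_ge (r n) 1 with h0 | h1
  · have h : r n = 0 := by omega
    rw [h] at hPn
    obtain ⟨m, hm, p, A, B, hrep⟩ := stub_orthantNotWitness n (Y n) (P n) hPn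
    refine ⟨m, hm.trans (Nat.pow_le_pow_right (by norm_num) ?_), p, A, B, hrep⟩
    calc (Nat.log 2 n + 1) ^ 1 = Nat.log 2 n + 1 := pow_one _
      _ ≤ Nat.log 2 n + 4 := by omega
      _ ≤ (Nat.log 2 n + 4) ^ 4 := Nat.le_self_pow (by norm_num) _
  · rcases Nat.lt_or_ge (r n) 2 with h1' | h2
    · have h : r n = 1 := by omega
      rw [h] at hPn
      exact stub_oneRowNotWitness n (Y n) (hY n) (P n) hPn
    · have h : r n = 2 := le_antisymm (hr n) h2
      rw [h] at hPn
      exact stub_twoRowsNotWitness n (Y n) (hY n) (P n) hPn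

/-- **Families with at most two positive constant rows fail the size clause of H+** (at level
`c = 4`, for every `n`): the third clause of `PermanentalConeHard` is false for them, so an H+
witness needs `r n ≥ 3` mixed rows somewhere (or non-positive entries).
[cite: SaundersonParrilo2014, Theorem 1] -/
theorem permanental_atMostTwoRows_not_hard (r : ℕ → ℕ) (Y : ∀ n : ℕ, Matrix (Fin n) (Fin n) ℝ)
    (hY : ∀ n i j, 0 < Y n i j) (hr : ∀ n, r n ≤ 2) (P : ∀ n : ℕ, MvPolynomial (Fin n) ℝ)
    (hP : ∀ n, P n = (Matrix.of fun i j : Fin n =>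
      if (i : ℕ) < r n then MvPolynomial.C (Y n i j) else MvPolynomial.X j).permanent) :
    ¬ ∀ c : ℕ, ∃ n : ℕ, ∀ m ≤ 2 ^ ((Nat.log 2 n + c) ^ c), ∀ (p : ℕ)
      (A : (Fin n → ℝ) × (Fin p → ℝ) →ₗ[ℝ] Matrix (Fin m) (Fin m) ℝ) (B : Matrix (Fin m) (Fin m) ℝ),
      ¬ ∀ x : Fin n → ℝ, (∀ τ : ℝ, 0 < τ → MvPolynomial.eval (fun j => x j + τ) (P n) ≠ 0) ↔
        ∃ y : Fin p → ℝ, (A (x, y) + B).PosSemidef := by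
  intro h
  obtain ⟨n, hn⟩ := h 4
  obtain ⟨m, hm, p, A, B, hrep⟩ := permanental_atMostTwoRows_lift r Y hY hr P hP n
  exact hn m hm p A B hrep

end TwoRows

end Summit.ValiantsHypothesis.ValiantsHypothesis.Theorems.PermanentalConesPermanentalConeHard

end
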